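import Mathlib.RingTheory.Derivation.Basic
import Mathlib.RingTheory.Localization.FractionRing
import Mathlib.Algebra.TrivSqZeroExt.Basic
import HarnessLib

/-!
# Extending a derivation from a domain to its field of fractions

Topic: `Literature/RingTheory/Localization`. Let `A` be a domain, `F` its field of fractions and
`K ⊇ F` a field (`A → F → K` a scalar tower). An `R`-derivation `d : A → K` extends UNIQUELY to an
`R`-derivation `D : F → K` (the quotient rule). We construct the extension through the dual numbers
`K[ε] = TrivSqZeroExt K K`: `a ↦ a + d(a)ε` is a ring homomorphism `A → K[ε]` sending non-zero
elements to units, so it factors through `F` (`IsLocalization.lift`), and the `ε`-component of the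
factorisation is the sought derivation.

* `Derivation.fractionFieldExtend d : Derivation R F K` and
  `Derivation.fractionFieldExtend_algebraMap : fractionFieldExtend d (algebraMap A F a) = d a`;
* `Derivation.eq_of_eqOn_algebraMap` — two derivations `F → K` agreeing on `A` are equal;
  `Derivation.eq_zero_of_forall_algebraMap` — a derivation `F → K` vanishing on `A` vanishes.

All statements are standard. [folklore]

## References

* N. Bourbaki, *Algebra II*, Ch. V §16 no. 2 (derivations extend uniquely to rings of fractions).
-/

noncomputable section

namespace Literature.RingTheory.Localization

open TrivSqZeroExt

variable {R A F K : Type*} [CommRing R] [CommRing A] [IsDomain A] [Field F] [Field K]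
  [Algebra R A] [Algebra R F] [Algebra R K] [Algebra A F] [IsFractionRing A F] [Algebra A K]
  [Algebra F K] [IsScalarTower A F K] [IsScalarTower R A F] [IsScalarTower R A K]

/-- The ring homomorphism `A → K[ε]`, `a ↦ a + d(a) ε`, attached to a derivation `d : A → K`.
[folklore] -/
def derivDualHom (d : Derivation R A K) : A →+* TrivSqZeroExt K K where
  toFun a := (algebraMap A K a, d a)
  map_one' := by
    ext
    · simp
    · simp [d.map_one_eq_zero]
  map_mul' a b := by
    ext
    · simp
    · change d (a * b) = algebraMap A K a • d b + MulOpposite.op (algebraMap A K b) • d a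
      rw [d.leibniz]
      simp only [MulOpposite.smul_eq_mul_unop, MulOpposite.unop_op, smul_eq_mul]
      rw [Algebra.smul_def, Algebra.smul_def]
      ring
  map_zero' := by
    ext <;> simp
  map_add' a b := by
    ext <;> simp

omit [IsDomain A] [IsScalarTower R A K] in
/-- `fst ∘ derivDualHom d = algebraMap A K`. [folklore] -/
@[simp] theorem fst_dualHom (d : Derivation R A K) (a : A) : (derivDualHom d a).fst = algebraMap A K a :=
  rfl

omit [IsDomain A] [IsScalarTower R A K] in
/-- `snd ∘ derivDualHom d = d`. [folklore] -/
@[simp] theorem snd_dualHom (d : Derivation R A K) (a : A) : (derivDualHom d a).snd = d a := rfl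

omit [IsScalarTower R A K] in
/-- Non-zero-divisors of `A` go to units of `K[ε]` when `A → K` is injective (their first
component is non-zero in the field `K`). [folklore] -/
theorem isUnit_dualHom (d : Derivation R A K) (hinj : Function.Injective (algebraMap A K))
    (y : nonZeroDivisors A) : IsUnit (derivDualHom d (y : A)) := by
  rw [isUnit_iff_isUnit_fst, fst_dualHom, isUnit_iff_ne_zero, map_ne_zero_iff _ hinj]
  exact nonZeroDivisors.coe_ne_zero y

omit [IsScalarTower R A F] [IsScalarTower R A K] [Algebra R F] [Algebra R A] [Algebra R K]
  [CommRing R] [IsDomain A] in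
include F in
/-- `A → K` is injective (it factors through the field of fractions). [folklore] -/
theorem algebraMap_injective_of_tower : Function.Injective (algebraMap A K) := by
  rw [IsScalarTower.algebraMap_eq A F K]
  exact (algebraMap F K).injective.comp (IsFractionRing.injective A F)

/-- The factorisation `F → K[ε]` of `derivDualHom d` through the field of fractions. [folklore] -/
def derivDualLift (d : Derivation R A K) : F →+* TrivSqZeroExt K K :=
  IsLocalization.lift (M := nonZeroDivisors A) (S := F)
    (isUnit_dualHom d (algebraMap_injective_of_tower (F := F)))

omit [Algebra R F] [IsScalarTower R A F] [IsScalarTower R A K] in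
/-- `derivDualLift d` extends `derivDualHom d`. [folklore] -/
@[simp] theorem dualLift_algebraMap (d : Derivation R A K) (a : A) :
    derivDualLift (F := F) d (algebraMap A F a) = derivDualHom d a :=
  IsLocalization.lift_eq (M := nonZeroDivisors A)
    (isUnit_dualHom d (algebraMap_injective_of_tower (F := F))) a

omit [Algebra R F] [IsScalarTower R A F] [IsScalarTower R A K] in
/-- The first component of `derivDualLift d` is the inclusion `F → K`. [folklore] -/
theorem fst_dualLift (d : Derivation R A K) (x : F) : (derivDualLift d x).fst = algebraMap F K x := by
  have h : (TrivSqZeroExt.fstHom K K K).toRingHom.comp (derivDualLift (F := F) d) = algebraMap F K := by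
    refine IsLocalization.ringHom_ext (nonZeroDivisors A) ?_
    ext a
    simp [IsScalarTower.algebraMap_apply A F K]
  exact congrArg (fun f : F →+* K => f x) h

/-- **Extension of a derivation to the field of fractions**: the unique `R`-derivation `F → K`
extending `d : A → K`. [folklore] -/
def _root_.Derivation.fractionFieldExtend (d : Derivation R A K) : Derivation R F K where
  toFun x := (derivDualLift d x).snd
  map_add' x y := by simp
  map_smul' r x := by
    have hr : (r • x : F) = algebraMap A F (algebraMap R A r) * x := by
      rw [Algebra.smul_def, IsScalarTower.algebraMap_apply R A F]
    rw [hr, map_mul, snd_mul, dualLift_algebraMap, fst_dualLift]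
    simp only [fst_dualHom, snd_dualHom, Derivation.map_algebraMap, smul_zero, add_zero,
      RingHom.id_apply, smul_eq_mul]
    rw [Algebra.smul_def, IsScalarTower.algebraMap_apply R A K,
      IsScalarTower.algebraMap_apply A F K, ← IsScalarTower.algebraMap_apply R A F]
  map_one_eq_zero' := by
    change (derivDualLift d 1).snd = 0
    rw [map_one]; rfl
  leibniz' x y := by
    change (derivDualLift d (x * y)).snd = x • (derivDualLift d y).snd + y • (derivDualLift d x).snd
    rw [map_mul, snd_mul, fst_dualLift, fst_dualLift]
    simp only [smul_eq_mul, MulOpposite.smul_eq_mul_unop, MulOpposite.unop_op, Algebra.smul_def]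
    ring

/-- The extension extends. [folklore] -/
@[simp] theorem _root_.Derivation.fractionFieldExtend_algebraMap (d : Derivation R A K) (a : A) :
    d.fractionFieldExtend (F := F) (algebraMap A F a) = d a := by
  change (derivDualLift d (algebraMap A F a)).snd = d a
  rw [dualLift_algebraMap]; rfl

omit [Algebra A K] [IsScalarTower A F K] [Algebra R K] [IsScalarTower R A K] [Algebra R A]
  [IsScalarTower R A F] in
/-- **A derivation of the field of fractions vanishing on `A` vanishes** (`0 = D(a) = D(x·b) =
b·D(x) + x·D(b) = b·D(x)` for `x = a/b`). [folklore] -/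
theorem _root_.Derivation.eq_zero_of_forall_algebraMap {M : Type*} [AddCommGroup M] [Module F M]
    [Module R M] (D : Derivation R F M)
    (h : ∀ a : A, D (algebraMap A F a) = 0) : D = 0 := by
  ext x
  obtain ⟨a, b, hb, rfl⟩ := IsFractionRing.div_surjective (A := A) x
  have hb0 : algebraMap A F b ≠ 0 := IsFractionRing.to_map_ne_zero_of_mem_nonZeroDivisors hb
  have hmul : algebraMap A F a / algebraMap A F b * algebraMap A F b = algebraMap A F a :=
    div_mul_cancel₀ _ hb0
  have := D.leibniz (algebraMap A F a / algebraMap A F b) (algebraMap A F b)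
  rw [hmul, h a, h b, smul_zero, zero_add] at this
  rw [Derivation.zero_apply]
  have h2 := congrArg (fun m => (algebraMap A F b)⁻¹ • m) this
  simp only [smul_zero, smul_smul, inv_mul_cancel₀ hb0, one_smul] at h2
  exact h2.symm

omit [Algebra A K] [IsScalarTower A F K] [Algebra R K] [IsScalarTower R A K] [Algebra R A]
  [IsScalarTower R A F] in
/-- **Uniqueness of the extension**: two derivations of `F` agreeing on `A` are equal.
[folklore] -/
theorem _root_.Derivation.eq_of_eqOn_algebraMap {M : Type*} [AddCommGroup M] [Module F M]
    [Module R M] {D₁ D₂ : Derivation R F M}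
    (h : ∀ a : A, D₁ (algebraMap A F a) = D₂ (algebraMap A F a)) : D₁ = D₂ := by
  have := (D₁ - D₂).eq_zero_of_forall_algebraMap (A := A) fun a => by
    rw [Derivation.sub_apply, h a, sub_self]
  exact sub_eq_zero.mp this

/-- The extension of `d` is characterised by extending `d`. [folklore] -/
theorem _root_.Derivation.eq_fractionFieldExtend {d : Derivation R A K} {D : Derivation R F K}
    (h : ∀ a : A, D (algebraMap A F a) = d a) : D = d.fractionFieldExtend :=
  Derivation.eq_of_eqOn_algebraMap (A := A) fun a => by rw [h a, d.fractionFieldExtend_algebraMap]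

end Literature.RingTheory.Localization
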